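import Mathlib
import Summits.Ventures.PercRepro2.V2SP
import Summits.Ventures.PercRepro2.HallOffFrame
import Summits.Ventures.PercRepro2.HallOffAxis
import Summits.Ventures.PercRepro2.Tail2DCount
import Summits.Ventures.PercRepro2.Tail2DThreePoint
import Summits.Ventures.PercRepro2.Tail2DP2Series
import Summits.Ventures.PercRepro2.Tail2DDisjointPaths
import Summits.Ventures.PercRepro2.Tail2DP2SeriesSP
import Summits.Ventures.PercRepro2.Tail2DAxisUnimodal
import Summits.Ventures.PercRepro2.Tail2DOffAxis31
import Summits.Ventures.PercRepro2.Tail2DRowOne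
import Summits.Ventures.PercRepro2.Tail2DStepRowZero
import Summits.Ventures.PercRepro2.Tail2DStepCert
import Summits.Ventures.PercRepro2.Tail2DOffAxisCert
import Summits.Ventures.PercRepro2.Tail2DStepFour
import Summits.Ventures.PercRepro2.Tail2DStepFive
import Summits.Ventures.PercRepro2.Tail2DOffAxisSix
import Summits.Ventures.PercRepro2.Tail2DOffAxisSeven
import Summits.Ventures.PercRepro2.Tail2DOffAxisEight
import Summits.Ventures.PercRepro2.Tail2DOffAxisNineCert2
import Summits.Ventures.PercRepro2.Tail2DOffAxisNineCert3
import Summits.Ventures.PercRepro2.Tail2DOffAxisNineCert4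

/-!
# The off-axis members `(9,j)`, `j = 2, 3, 4`, on every series–parallel network
(seat mine-b, cell pub-perc-repro2; MINE-B.md §37.8)

`T(9,j) ≤ T(8,j+1)` for `j = 2, 3, 4`, proved together by induction over the grammar: the parallel
steps are the certificates `off9j_par` (one file each) over the STEP members with `j ≤ 5`, the axis and row-`1`
weights, the landed off-axis members and the members themselves; the series steps multiply the tails
(`card_tail_ser`).
-/

namespace Summit.Ventures.PercRepro2.Tail2D

open V2Closure

/-- **the off-axis members `(9,j)`, `j = 2, 3, 4`, on every pattern of the grammar** -/
theorem offaxis_nine : ∀ s : V2Closure.SP,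
    ((Finset.univ.filter (fun y : s.Conf => 9 ≤ s.rLab y ∧ 2 ≤ s.bLab y)).card
      ≤ (Finset.univ.filter (fun y : s.Conf => 9 - 1 ≤ s.rLab y ∧ 2 + 1 ≤ s.bLab y)).card)
    ∧ ((Finset.univ.filter (fun y : s.Conf => 9 ≤ s.rLab y ∧ 3 ≤ s.bLab y)).card
      ≤ (Finset.univ.filter (fun y : s.Conf => 9 - 1 ≤ s.rLab y ∧ 3 + 1 ≤ s.bLab y)).card)
    ∧ ((Finset.univ.filter (fun y : s.Conf => 9 ≤ s.rLab y ∧ 4 ≤ s.bLab y)).card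
      ≤ (Finset.univ.filter (fun y : s.Conf => 9 - 1 ≤ s.rLab y ∧ 4 + 1 ≤ s.bLab y)).card)
  | .free => ⟨offaxis_atom .free (Or.inl rfl) 9 2 (by norm_num), offaxis_atom .free (Or.inl rfl) 9 3 (by norm_num), offaxis_atom .free (Or.inl rfl) 9 4 (by norm_num)⟩
  | .pin => ⟨offaxis_atom .pin (Or.inr (Or.inl rfl)) 9 2 (by norm_num), offaxis_atom .pin (Or.inr (Or.inl rfl)) 9 3 (by norm_num), offaxis_atom .pin (Or.inr (Or.inl rfl)) 9 4 (by norm_num)⟩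
  | .absent => ⟨offaxis_atom .absent (Or.inr (Or.inr rfl)) 9 2 (by norm_num), offaxis_atom .absent (Or.inr (Or.inr rfl)) 9 3 (by norm_num), offaxis_atom .absent (Or.inr (Or.inr rfl)) 9 4 (by norm_num)⟩
  | .ser s t => by
    have ihs := offaxis_nine s
    have iht := offaxis_nine t
    refine ⟨?_, ?_, ?_⟩ <;> rw [card_tail_ser, card_tail_ser]
    · exact Nat.mul_le_mul ihs.1 iht.1
    · exact Nat.mul_le_mul ihs.2.1 iht.2.1
    · exact Nat.mul_le_mul ihs.2.2 iht.2.2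
  | .par s t => by
    have ihs := offaxis_nine s
    have iht := offaxis_nine t
    exact ⟨(offaxis_iff (.par s t) 9 2 (by norm_num)).2 (off92_par s t (le_of_eq (sum_phi_offset_one_zero s 2).symm) (SP.hallFn_phi_axis_count s 4 (by norm_num)) (SP.sum_phi_row_nonneg s 4 (by norm_num)) ((offaxis_iff s 4 2 (by norm_num)).1 (t42_le_t33 s)) (SP.hallFn_phi_axis_count s 5 (by norm_num)) (SP.sum_phi_row_nonneg s 5 (by norm_num)) ((offaxis_iff s 5 2 (by norm_num)).1 (t52_le_t43 s)) (SP.hallFn_phi_axis_count s 6 (by norm_num)) (SP.sum_phi_row_nonneg s 6 (by norm_num)) ((offaxis_iff s 6 2 (by norm_num)).1 (t62_le_t53 s)) (SP.hallFn_phi_axis_count s 7 (by norm_num)) (SP.sum_phi_row_nonneg s 7 (by norm_num)) ((offaxis_iff s 7 2 (by norm_num)).1 (t72_le_t63 s)) (SP.hallFn_phi_axis_count s 8 (by norm_num)) (SP.sum_phi_row_nonneg s 8 (by norm_num)) ((offaxis_iff s 8 2 (by norm_num)).1 (t82_le_t73 s)) (SP.hallFn_phi_axis_count s 9 (by norm_num))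 (SP.sum_phi_row_nonneg s 9 (by norm_num)) ((offaxis_iff s 9 2 (by norm_num)).1 ihs.1) ((step_iff' s 1 5).1 (step_five s).1) (le_of_eq (sum_phi_offset_one_zero t 2).symm) (SP.hallFn_phi_axis_count t 4 (by norm_num)) (SP.sum_phi_row_nonneg t 4 (by norm_num)) ((offaxis_iff t 4 2 (by norm_num)).1 (t42_le_t33 t)) (SP.hallFn_phi_axis_count t 5 (by norm_num)) (SP.sum_phi_row_nonneg t 5 (by norm_num)) ((offaxis_iff t 5 2 (by norm_num)).1 (t52_le_t43 t)) (SP.hallFn_phi_axis_count t 6 (by norm_num)) (SP.sum_phi_row_nonneg t 6 (by norm_num)) ((offaxis_iff t 6 2 (by norm_num)).1 (t62_le_t53 t)) (SP.hallFn_phi_axis_count t 7 (by norm_num)) (SP.sum_phi_row_nonneg t 7 (by norm_num)) ((offaxis_iff t 7 2 (by norm_num)).1 (t72_le_t63 t)) (SP.hallFn_phi_axis_count t 8 (by norm_num)) (SP.sum_phi_row_nonneg t 8 (by norm_num)) ((offaxis_iff t 8 2 (by norm_num)).1 (t82_le_t73 t)) (SP.hallFn_phi_axis_count t 9 (by norm_num))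 (SP.sum_phi_row_nonneg t 9 (by norm_num)) ((offaxis_iff t 9 2 (by norm_num)).1 iht.1) (SP.sum_psi_zero_nonneg t 5 (by norm_num))),
      (offaxis_iff (.par s t) 9 3 (by norm_num)).2 (off93_par s t ((offaxis_iff s 4 2 (by norm_num)).1 (t42_le_t33 s)) (le_of_eq (sum_phi_offset_one_zero s 3).symm) (SP.hallFn_phi_axis_count s 5 (by norm_num)) (SP.sum_phi_row_nonneg s 5 (by norm_num)) ((offaxis_iff s 5 2 (by norm_num)).1 (t52_le_t43 s)) ((offaxis_iff s 5 3 (by norm_num)).1 (t53_le_t44 s)) (SP.hallFn_phi_axis_count s 6 (by norm_num)) (SP.sum_phi_row_nonneg s 6 (by norm_num)) ((offaxis_iff s 6 2 (by norm_num)).1 (t62_le_t53 s)) ((offaxis_iff s 6 3 (by norm_num)).1 (t63_le_t54 s)) (SP.hallFn_phi_axis_count s 7 (by norm_num)) (SP.sum_phi_row_nonneg s 7 (by norm_num)) ((offaxis_iff s 7 2 (by norm_num)).1 (t72_le_t63 s)) ((offaxis_iff s 7 3 (by norm_num)).1 (t73_le_t64 s)) (SP.hallFn_phi_axis_count s 8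 (by norm_num)) (SP.sum_phi_row_nonneg s 8 (by norm_num)) ((offaxis_iff s 8 2 (by norm_num)).1 (t82_le_t73 s)) ((offaxis_iff s 8 3 (by norm_num)).1 (t83_le_t74 s)) (SP.hallFn_phi_axis_count s 9 (by norm_num)) (SP.sum_phi_row_nonneg s 9 (by norm_num)) ((offaxis_iff s 9 2 (by norm_num)).1 ihs.1) ((offaxis_iff s 9 3 (by norm_num)).1 ihs.2.1) (SP.sum_psi_zero_nonneg s 5 (by norm_num)) ((step_iff' s 1 4).1 (step_four s).1) ((offaxis_iff t 4 2 (by norm_num)).1 (t42_le_t33 t)) (le_of_eq (sum_phi_offset_one_zero t 3).symm) (SP.hallFn_phi_axis_count t 5 (by norm_num)) (SP.sum_phi_row_nonneg t 5 (by norm_num)) ((offaxis_iff t 5 2 (by norm_num)).1 (t52_le_t43 t)) ((offaxis_iff t 5 3 (by norm_num)).1 (t53_le_t44 t)) (SP.hallFn_phi_axis_count t 6 (by norm_num)) (SP.sum_phi_row_nonneg t 6 (by norm_num)) ((offaxis_iff t 6 2 (by norm_num)).1 (t62_le_t53 t)) ((offaxis_iff t 6 3 (by norm_num)).1 (t63_le_t54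 t)) (SP.hallFn_phi_axis_count t 7 (by norm_num)) (SP.sum_phi_row_nonneg t 7 (by norm_num)) ((offaxis_iff t 7 2 (by norm_num)).1 (t72_le_t63 t)) ((offaxis_iff t 7 3 (by norm_num)).1 (t73_le_t64 t)) (SP.hallFn_phi_axis_count t 8 (by norm_num)) (SP.sum_phi_row_nonneg t 8 (by norm_num)) ((offaxis_iff t 8 2 (by norm_num)).1 (t82_le_t73 t)) ((offaxis_iff t 8 3 (by norm_num)).1 (t83_le_t74 t)) (SP.hallFn_phi_axis_count t 9 (by norm_num)) (SP.sum_phi_row_nonneg t 9 (by norm_num)) ((offaxis_iff t 9 2 (by norm_num)).1 iht.1) ((offaxis_iff t 9 3 (by norm_num)).1 iht.2.1) (SP.sum_psi_zero_nonneg t 4 (by norm_num)) (SP.sum_psi_zero_nonneg t 5 (by norm_num)) ((step_iff' t 1 4).1 (step_four t).1)),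
      (offaxis_iff (.par s t) 9 4 (by norm_num)).2 (off94_par s t ((offaxis_iff s 5 3 (by norm_num)).1 (t53_le_t44 s)) (le_of_eq (sum_phi_offset_one_zero s 4).symm) (SP.hallFn_phi_axis_count s 6 (by norm_num)) (SP.sum_phi_row_nonneg s 6 (by norm_num)) ((offaxis_iff s 6 2 (by norm_num)).1 (t62_le_t53 s)) ((offaxis_iff s 6 3 (by norm_num)).1 (t63_le_t54 s)) ((offaxis_iff s 6 4 (by norm_num)).1 (t64_le_t55 s)) (SP.hallFn_phi_axis_count s 7 (by norm_num)) (SP.sum_phi_row_nonneg s 7 (by norm_num)) ((offaxis_iff s 7 2 (by norm_num)).1 (t72_le_t63 s)) ((offaxis_iff s 7 3 (by norm_num)).1 (t73_le_t64 s)) ((offaxis_iff s 7 4 (by norm_num)).1 (t74_le_t65 s)) (SP.hallFn_phi_axis_count s 8 (by norm_num)) (SP.sum_phi_row_nonneg s 8 (by norm_num)) ((offaxis_iff s 8 2 (by norm_num)).1 (t82_le_t73 s)) ((offaxis_iff s 8 3 (by norm_num)).1 (t83_le_t74 s)) ((offaxis_iff s 8 4 (by norm_num)).1 (t84_le_t75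 s)) (SP.hallFn_phi_axis_count s 9 (by norm_num)) (SP.sum_phi_row_nonneg s 9 (by norm_num)) ((offaxis_iff s 9 2 (by norm_num)).1 ihs.1) ((offaxis_iff s 9 3 (by norm_num)).1 ihs.2.1) ((offaxis_iff s 9 4 (by norm_num)).1 ihs.2.2) (SP.sum_psi_zero_nonneg s 5 (by norm_num)) ((step_iff' s 1 5).1 (step_five s).1) ((step_iff' s 2 5).1 (step_five s).2.1) (SP.hallFn_phi_axis_count t 5 (by norm_num)) (SP.sum_phi_row_nonneg t 5 (by norm_num)) ((offaxis_iff t 5 2 (by norm_num)).1 (t52_le_t43 t)) ((offaxis_iff t 5 3 (by norm_num)).1 (t53_le_t44 t)) (le_of_eq (sum_phi_offset_one_zero t 4).symm) (SP.hallFn_phi_axis_count t 6 (by norm_num)) (SP.sum_phi_row_nonneg t 6 (by norm_num)) ((offaxis_iff t 6 2 (by norm_num)).1 (t62_le_t53 t)) ((offaxis_iff t 6 3 (by norm_num)).1 (t63_le_t54 t)) ((offaxis_iff t 6 4 (by norm_num)).1 (t64_le_t55 t)) (SP.hallFn_phi_axis_count t 7 (by norm_num)) (SP.sum_phi_row_nonneg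 t 7 (by norm_num)) ((offaxis_iff t 7 2 (by norm_num)).1 (t72_le_t63 t)) ((offaxis_iff t 7 3 (by norm_num)).1 (t73_le_t64 t)) ((offaxis_iff t 7 4 (by norm_num)).1 (t74_le_t65 t)) (SP.hallFn_phi_axis_count t 8 (by norm_num)) (SP.sum_phi_row_nonneg t 8 (by norm_num)) ((offaxis_iff t 8 2 (by norm_num)).1 (t82_le_t73 t)) ((offaxis_iff t 8 3 (by norm_num)).1 (t83_le_t74 t)) ((offaxis_iff t 8 4 (by norm_num)).1 (t84_le_t75 t)) (SP.hallFn_phi_axis_count t 9 (by norm_num)) (SP.sum_phi_row_nonneg t 9 (by norm_num)) ((offaxis_iff t 9 2 (by norm_num)).1 iht.1) ((offaxis_iff t 9 3 (by norm_num)).1 iht.2.1) ((offaxis_iff t 9 4 (by norm_num)).1 iht.2.2) ((step_iff' t 1 5).1 (step_five t).1) ((step_iff' t 2 5).1 (step_five t).2.1))⟩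

/-- `T(9,2) ≤ T(8,3)` on every pattern of the grammar -/
theorem t92_le_t83 (s : V2Closure.SP) :
    (Finset.univ.filter (fun y : s.Conf => 9 ≤ s.rLab y ∧ 2 ≤ s.bLab y)).card
      ≤ (Finset.univ.filter (fun y : s.Conf => 8 ≤ s.rLab y ∧ 3 ≤ s.bLab y)).card :=
  (offaxis_nine s).1


/-- `T(9,3) ≤ T(8,4)` on every pattern of the grammar -/
theorem t93_le_t84 (s : V2Closure.SP) :
    (Finset.univ.filter (fun y : s.Conf => 9 ≤ s.rLab y ∧ 3 ≤ s.bLab y)).card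
      ≤ (Finset.univ.filter (fun y : s.Conf => 8 ≤ s.rLab y ∧ 4 ≤ s.bLab y)).card :=
  (offaxis_nine s).2.1


/-- `T(9,4) ≤ T(8,5)` on every pattern of the grammar -/
theorem t94_le_t85 (s : V2Closure.SP) :
    (Finset.univ.filter (fun y : s.Conf => 9 ≤ s.rLab y ∧ 4 ≤ s.bLab y)).card
      ≤ (Finset.univ.filter (fun y : s.Conf => 8 ≤ s.rLab y ∧ 5 ≤ s.bLab y)).card :=
  (offaxis_nine s).2.2


end Summit.Ventures.PercRepro2.Tail2D
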